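import Literature.AlgebraicGeometry.HodgeTheory.AbelianVarietyTorsionPointsDense
import Literature.AlgebraicGeometry.Motives.AbelianVarietyComplexPoints
import Literature.AlgebraicGeometry.Motives.AlgPointsSeparate
import HarnessLib

/-!
# Torsion points separate homomorphisms of complex abelian varieties
# (Mumford, *Abelian Varieties* §4; Shimura 1998, §21.4: «since `r(w)^σ = λ(r(cw))`, `λ` is uniquely determined by `σ`»)

A homomorphism `f : A → B` of abelian varieties over `ℂ` is determined by its values on the points of
finite order of `A(ℂ)`: the torsion points are dense in `A(ℂ)` for the strong topology (the tree's
`HodgeTheory.AbelianVariety.dense_iUnion_torsionPoints`, Mumford §1 / Walters Thm. 5.11), the map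
`P ↦ f(P)` on complex points is continuous into the Hausdorff `B(ℂ)` (`AlgPoints.continuous_map`,
`AbelianVariety.Points.instT2Space`), and `ℂ`-points separate morphisms from the reduced finite-type
`A` to the separated `B` (`SchemeOver.hom_ext_of_forall_algPoints`, Mumford §4).  This is the
uniqueness step of Shimura's proof of Casselman's theorem [Shimura1998, Thm. 21.4, pp. 147–148]: the
isomorphism `λ_σ : A → A^σ` is pinned by `r(w)^σ = λ_σ(r(c_σ w))` on the torsion parametrisation
`r(K/𝔞)` = all points of finite order, hence «`λ` is also uniquely determined by `σ`», whence the
cocycle rule `λ_{στ} = λ_σ^τ λ_τ`.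

* `AbelianVariety.hom_ext_of_forall_torsionPoints` — `f = g` if `f(P) = g(P)` for every `P ∈ A[n](ℂ)`, `n ≥ 1`;
* `AbelianVariety.eq_zero_of_forall_torsionPoints` — `f = 0` if `f` kills every torsion point.

Everything is proved; no definition, no named fact.

## References

* [MumfordAV1970] D. Mumford, *Abelian Varieties* (1970), §4 (homomorphisms are determined by geometric
  points), §1 (1)–(2) (`A(ℂ) = ℂ^g/L`).
* [Shimura1998] G. Shimura, *Abelian Varieties with Complex Multiplication and Modular Functions* (1998),
  §21.4, proof of Thm. 21.4, pp. 147–148 («`λ` is also uniquely determined by `σ`»); §17.1 (points of finite order).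
-/

noncomputable section

open CategoryTheory AlgebraicGeometry

namespace Literature.AlgebraicGeometry.Motives

namespace AbelianVariety

variable {A B : AbelianVariety ℂ}

/-- **Torsion points separate homomorphisms of complex abelian varieties**: if `f(P) = g(P)` for all
points `P ∈ A(ℂ)` of finite order then `f = g` (torsion points are dense in `A(ℂ)`, `P ↦ f(P)` is
continuous into the Hausdorff `B(ℂ)`, and `ℂ`-points separate morphisms; Mumford §4, and the sentence
«since `r(w)^σ = λ(r(cw))`, `λ` is also uniquely determined by `σ`» of Shimura's proof of Thm. 21.4).
[cite: Shimura1998, §21.4, proof of Thm. 21.4, pp. 147–148] [cite: MumfordAV1970, §4] -/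
theorem hom_ext_of_forall_torsionPoints {f g : A ⟶ B}
    (h : ∀ n : ℕ, 0 < n → ∀ P ∈ A.torsionPoints ℂ (n : ℤ),
      AlgPoints.map f.hom.hom.hom P = AlgPoints.map g.hom.hom.hom P) : f = g := by
  have : IsReduced A.X.left := isReduced_left A
  -- the two continuous maps `A(ℂ) → B(ℂ)` agree on the dense torsion, hence everywhere
  have heq : (AlgPoints.map (L := ℂ) f.hom.hom.hom : A.Points ℂ → B.Points ℂ) =
      AlgPoints.map (L := ℂ) g.hom.hom.hom := by
    refine Continuous.ext_on (HodgeTheory.AbelianVariety.dense_iUnion_torsionPoints A)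
      (AlgPoints.continuous_map _) (AlgPoints.continuous_map _) ?_
    intro P hP
    obtain ⟨n, hn⟩ := Set.mem_iUnion.1 hP
    exact h n n.2 P hn
  refine hom_ext f g (SchemeOver.hom_ext_of_forall_algPoints ℂ fun P ↦ ?_)
  exact congrFun heq P

/-- **A homomorphism of complex abelian varieties killing every point of finite order is zero.**
[cite: MumfordAV1970, §4] -/
theorem eq_zero_of_forall_torsionPoints {f : A ⟶ B}
    (h : ∀ n : ℕ, 0 < n → ∀ P ∈ A.torsionPoints ℂ (n : ℤ), AlgPoints.map f.hom.hom.hom P = 1) : f = 0 := by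
  refine hom_ext_of_forall_torsionPoints fun n hn P hP ↦ ?_
  rw [h n hn P hP]
  exact (MonObj.comp_one P).symm

end AbelianVariety

end Literature.AlgebraicGeometry.Motives

end
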